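import Mathlib.Analysis.Calculus.FDeriv.Prod
import Literature.Geometry.Lorentzian.GeodesicProofs
import Literature.Geometry.Lorentzian.LeviCivitaProofs
import Literature.Geometry.Lorentzian.Causality
import Literature.Analysis.ODE.QuadraticAccelerationEscape
import HarnessLib

/-!
# Affinely parametrised geodesic rays have no endpoint

For a `C¹` covariant derivative `cov` on the tangent bundle of a Hausdorff manifold `M`
(finite-dimensional model space) we prove: **a geodesic `γ` of `cov` on a parameter ray `[a, ∞)`
whose velocity vanishes nowhere on the ray does not converge in `M` as `t → ∞`**
(`IsGeodesicOn.not_tendsto_nhds_of_velocity_ne_zero`); in the language of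
`Literature.Geometry.Lorentzian.Causality` it is *future endless* on `Ici a`
(`IsGeodesicOn.isFutureEndless_Ici_of_velocity_ne_zero`); time duals on `Iic a`
(`IsGeodesicOn.not_tendsto_atBot_nhds_of_velocity_ne_zero`,
`IsGeodesicOn.isPastEndless_Iic_of_velocity_ne_zero`) and the two-sided statement for complete
geodesics (`IsGeodesic.isFutureEndless_and_isPastEndless_of_velocity_ne_zero`). The Levi-Civita
specialisations for a `C²` pseudo-Riemannian metric are
`PseudoRiemannianMetric.isFutureEndless_Ici_of_isGeodesicOn` and
`PseudoRiemannianMetric.isPastEndless_Iic_of_isGeodesicOn`.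

This is the form in which causality theory uses "a future-inextendible null geodesic": an affinely
parametrised causal geodesic defined on `[0, ∞)` is future-inextendible as a causal curve
(O'Neill 1983, Ch. 5, Lemma 8, p. 130: a geodesic in a compact set with bounded domain is
extendible — equivalently, continuous extendibility to the endpoint of the domain forces geodesic
extendibility; Lee, *Introduction to Riemannian Manifolds* (2018), Lemma 6.19 "escape lemma").
For the complete ray `[a, ∞)` the content is that convergence `γ(t) → p` is incompatible with an
affine parameter running to `+∞` unless `γ' = 0`.

## Proof

Read the 1-jet of `γ` in the chart at the would-be limit `p`: by
`hasDerivAt_oneJet_of_covariantDerivAlong_eq_zero` (with the `C¹` Christoffel data of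
`exists_christoffelChart`) the coordinate curve `x = φ ∘ γ` and its chart velocity `u` satisfy
`x' = u`, `u' = -Γ_{γ t}(u, u)` for all large `t`, and `Γ` is bounded near `p`, so `‖u'‖ ≤ C ‖u‖²`;
`u ≠ 0` because the trivialisation is fibrewise injective. The calculus lemma
`Literature.Analysis.ODE.not_tendsto_nhds_of_norm_accel_le` (scaling: on the window
`[t₁, t₁ + S/‖u t₁‖]` the curve moves by at least `S/2` in the chart) shows that such an `x`
cannot converge, whereas `x → φ p`.

No definitions and no named facts are introduced.

## References

* B. O'Neill, *Semi-Riemannian geometry with applications to relativity*, Academic Press 1983,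
  Ch. 3, Cor. 21 (geodesic equations in a chart), Ch. 5, Lemma 8 (p. 130). Key `ONeill1983`.
* J. M. Lee, *Introduction to Riemannian Manifolds*, 2nd ed., Springer GTM 176 (2018),
  Lemma 6.19 and Cor. 6.20.
* S. W. Hawking, G. F. R. Ellis, *The large scale structure of space-time*, CUP 1973, §6.2
  (endpoints of causal curves), §6.4 (imprisoned inextendible curves).
-/

noncomputable section

open Bundle Set Filter
open scoped Manifold ContDiff Topology

namespace Literature.Geometry.Lorentzian

variable {E : Type*} [NormedAddCommGroup E] [NormedSpace ℝ E] {H : Type*} [TopologicalSpace H]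
  {I : ModelWithCorners ℝ E H} {M : Type*} [TopologicalSpace M] [ChartedSpace H M]
  [IsManifold I ∞ M]

section Connection

variable [FiniteDimensional ℝ E] {cov : CovariantDerivative I E (TangentSpace I : M → Type _)}

/-- **An affinely parametrised geodesic ray with non-vanishing velocity does not converge.** For a
`C¹` connection on a Hausdorff manifold, if `γ` is a geodesic on `[a, ∞)` with `γ' t ≠ 0` for all
`t ≥ a`, then `γ t` has no limit in `M` as `t → ∞`. In the chart at a would-be limit `p` the
1-jet `(x, u)` of `γ` solves `x' = u`, `u' = -Γ(u, u)` with `Γ` bounded near `p`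
(`hasDerivAt_oneJet_of_covariantDerivAlong_eq_zero`, `exists_christoffelChart`), and a curve with
`‖x''‖ ≤ C ‖x'‖²`, `x' ≠ 0` cannot converge
(`Literature.Analysis.ODE.not_tendsto_nhds_of_norm_accel_le`). O'Neill 1983, Ch. 5, Lemma 8
(p. 130); Lee 2018, Lemma 6.19. [cite: ONeill1983, Ch. 5, Lemma 8] -/
theorem IsGeodesicOn.not_tendsto_nhds_of_velocity_ne_zero [T2Space M]
    [CovariantDerivative.ContMDiffCovariantDerivative cov 1]
    {γ : ℝ → M} {a : ℝ} (hγ : IsGeodesicOn cov γ (Ici a))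
    (hv : ∀ t, a ≤ t → velocity I γ t ≠ 0) (p : M) : ¬ Tendsto γ atTop (𝓝 p) := by
  intro hp
  set b := Module.finBasis ℝ E with hb_def
  obtain ⟨N, Ĉ, hN, hpN, hNs, hĈ, hĈs⟩ := exists_christoffelChart (cov := cov) b p
  set φ := extChartAt I p with hφ_def
  set e₁ := trivializationAt E (TangentSpace I : M → Type _) p with he₁_def
  -- the coefficient functionals of the basis, as a continuous linear map to `ι → ℝ`
  set L : E →L[ℝ] (Fin (Module.finrank ℝ E) → ℝ) :=
    (b.equivFun.toContinuousLinearEquiv : E →L[ℝ] (Fin (Module.finrank ℝ E) → ℝ)) with hL_def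
  have hLrepr : ∀ (v : E) (i), b.repr v i = L v i := fun v i ↦ by
    simp [hL_def, Module.Basis.equivFun_apply]
  -- a bound for the Christoffel maps near `p`
  have hbd : ∀ᶠ y in 𝓝 p, ∀ i, ‖Ĉ i y‖ ≤ ‖Ĉ i p‖ + 1 := by
    refine eventually_all.2 fun i ↦ ?_
    have hc : ContinuousAt (fun y ↦ ‖Ĉ i y‖) p := (hĈs i).continuousAt.norm
    exact (hc.eventually (gt_mem_nhds (lt_add_one ‖Ĉ i p‖))).mono fun y hy ↦ hy.le
  set C : ℝ := ‖L‖ * ∑ i, (‖Ĉ i p‖ + 1) with hC_def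
  -- eventually the ray is in `N` and the bound holds
  have hev : ∀ᶠ t in atTop, (γ t ∈ N ∧ ∀ i, ‖Ĉ i (γ t)‖ ≤ ‖Ĉ i p‖ + 1) ∧ a ≤ t :=
    (hp.eventually ((show ∀ᶠ y in 𝓝 p, y ∈ N from hN.mem_nhds hpN).and hbd)).and
      (eventually_ge_atTop a)
  obtain ⟨t₀, ht₀⟩ := eventually_atTop.1 hev
  -- the 1-jet of `γ` in the chart at `p`
  set x : ℝ → E := fun t ↦ φ (γ t) with hx_def
  set u : ℝ → E := fun t ↦ (e₁ (tangentLift I γ t)).2 with hu_def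
  set w : ℝ → E := fun t ↦ -∑ i, b.repr (u t) i • Ĉ i (γ t) (u t) with hw_def
  have hder : ∀ t, t₀ ≤ t → HasDerivAt x (u t) t ∧ HasDerivAt u (w t) t := by
    intro t ht
    obtain ⟨⟨htN, -⟩, hta⟩ := ht₀ t ht
    have hd := hasDerivAt_oneJet_of_covariantDerivAlong_eq_zero (cov := cov) b hNs Ĉ hĈ htN
      (hγ.1 t hta) (hγ.2 t hta)
    refine ⟨?_, ?_⟩
    · exact (ContinuousLinearMap.fst ℝ E E).hasFDerivAt.comp_hasDerivAt t hd
    · exact (ContinuousLinearMap.snd ℝ E E).hasFDerivAt.comp_hasDerivAt t hd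
  have hwb : ∀ t, t₀ ≤ t → ‖w t‖ ≤ C * ‖u t‖ ^ 2 := by
    intro t ht
    obtain ⟨⟨-, hbt⟩, -⟩ := ht₀ t ht
    calc ‖w t‖ = ‖∑ i, b.repr (u t) i • Ĉ i (γ t) (u t)‖ := by rw [hw_def, norm_neg]
      _ ≤ ∑ i, ‖b.repr (u t) i • Ĉ i (γ t) (u t)‖ := norm_sum_le _ _
      _ ≤ ∑ i, (‖L‖ * ‖u t‖) * ((‖Ĉ i p‖ + 1) * ‖u t‖) := by
          refine Finset.sum_le_sum fun i _ ↦ ?_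
          rw [norm_smul]
          refine mul_le_mul ?_ ?_ (norm_nonneg _) (by positivity)
          · rw [hLrepr, Real.norm_eq_abs]
            exact (norm_le_pi_norm (L (u t)) i).trans' (le_of_eq (Real.norm_eq_abs _).symm)
              |>.trans (L.le_opNorm (u t))
          · exact (ContinuousLinearMap.le_opNorm _ _).trans
              (mul_le_mul_of_nonneg_right (hbt i) (norm_nonneg _))
      _ = C * ‖u t‖ ^ 2 := by
          rw [hC_def, Finset.mul_sum, Finset.sum_mul]
          refine Finset.sum_congr rfl fun i _ ↦ ?_
          ring
  have hu0 : ∀ t, t₀ ≤ t → u t ≠ 0 := by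
    intro t ht hut
    obtain ⟨⟨htN, -⟩, hta⟩ := ht₀ t ht
    have hte : γ t ∈ e₁.baseSet := by simpa [he₁_def] using hNs htN
    apply hv t hta
    have h1 : e₁.continuousLinearEquivAt ℝ (γ t) hte (velocity I γ t) = 0 := by
      rw [Trivialization.coe_continuousLinearEquivAt_eq,
        Trivialization.continuousLinearMapAt_apply_of_mem ℝ _ hte]
      exact hut
    exact (e₁.continuousLinearEquivAt ℝ (γ t) hte).map_eq_zero_iff.1 h1
  have hxlim : Tendsto x atTop (𝓝 (φ p)) := (continuousAt_extChartAt (I := I) p).tendsto.comp hp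
  exact Literature.Analysis.ODE.not_tendsto_nhds_of_norm_accel_le (fun t ht ↦ (hder t ht).1)
    (fun t ht ↦ (hder t ht).2) hwb hu0 (φ p) hxlim

/-- **An affinely parametrised geodesic ray with non-vanishing velocity is future endless**: under
the hypotheses of `IsGeodesicOn.not_tendsto_nhds_of_velocity_ne_zero`, `γ` has no future endpoint
on `[a, ∞)` (`IsFutureEndless`, Hawking–Ellis 1973, §6.2: a future endpoint on a parameter ray is a
limit at `+∞`, `hasFutureEndpoint_iff_tendsto_atTop`). This is the sense in which a future-complete
affinely parametrised causal geodesic is a future-inextendible causal curve in causality theory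
(Hawking–Ellis 1973, §6.4; O'Neill 1983, Ch. 5, Lemma 8 and Ch. 14, Lemma 13).
[cite: ONeill1983, Ch. 5, Lemma 8] -/
theorem IsGeodesicOn.isFutureEndless_Ici_of_velocity_ne_zero [T2Space M]
    [CovariantDerivative.ContMDiffCovariantDerivative cov 1]
    {γ : ℝ → M} {a : ℝ} (hγ : IsGeodesicOn cov γ (Ici a))
    (hv : ∀ t, a ≤ t → velocity I γ t ≠ 0) : IsFutureEndless γ (Ici a) :=
  ⟨nonempty_Ici, fun p hP ↦ hγ.not_tendsto_nhds_of_velocity_ne_zero hv p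
    ((hasFutureEndpoint_iff_tendsto_atTop Subset.rfl).mp hP)⟩

/-- **Time dual**: a geodesic on `(-∞, a]` with non-vanishing velocity does not converge as
`t → -∞` (apply `IsGeodesicOn.not_tendsto_nhds_of_velocity_ne_zero` to the affine
reparametrisation `t ↦ γ (-t)`, a geodesic on `[-a, ∞)` by `IsGeodesicOn.comp_affine_holds`,
O'Neill 1983, Ch. 3, Lemma 26). O'Neill 1983, Ch. 5, Lemma 8. [cite: ONeill1983, Ch. 5, Lemma 8] -/
theorem IsGeodesicOn.not_tendsto_atBot_nhds_of_velocity_ne_zero [T2Space M]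
    [CovariantDerivative.ContMDiffCovariantDerivative cov 1]
    {γ : ℝ → M} {a : ℝ} (hγ : IsGeodesicOn cov γ (Iic a))
    (hv : ∀ t, t ≤ a → velocity I γ t ≠ 0) (p : M) : ¬ Tendsto γ atBot (𝓝 p) := by
  intro hp
  set β : ℝ → M := fun t ↦ γ (-1 * t + 0) with hβ
  have hβg : IsGeodesicOn cov β (Ici (-a)) := by
    refine (IsGeodesicOn.comp_affine_holds hγ (-1) 0).mono fun t ht ↦ ?_
    simp only [mem_preimage, mem_Iic]
    linarith [mem_Ici.1 ht]
  have hβv : ∀ t, -a ≤ t → velocity I β t ≠ 0 := by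
    intro t ht
    rw [hβ, velocity_comp_affine]
    exact smul_ne_zero (by norm_num) (hv _ (by linarith))
  have h1 : Tendsto (fun t : ℝ ↦ -1 * t + 0) atTop atBot := by
    have h2 : (fun t : ℝ ↦ -1 * t + 0) = fun t ↦ -t := by
      funext t
      ring
    rw [h2]
    exact tendsto_neg_atTop_atBot
  exact hβg.not_tendsto_nhds_of_velocity_ne_zero hβv p (hp.comp h1)

/-- **Time dual**: a geodesic on `(-∞, a]` with non-vanishing velocity is past endless (no past
endpoint; `hasPastEndpoint_iff_tendsto_atBot`). Hawking–Ellis 1973, §6.2; O'Neill 1983, Ch. 5,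
Lemma 8. [cite: ONeill1983, Ch. 5, Lemma 8] -/
theorem IsGeodesicOn.isPastEndless_Iic_of_velocity_ne_zero [T2Space M]
    [CovariantDerivative.ContMDiffCovariantDerivative cov 1]
    {γ : ℝ → M} {a : ℝ} (hγ : IsGeodesicOn cov γ (Iic a))
    (hv : ∀ t, t ≤ a → velocity I γ t ≠ 0) : IsPastEndless γ (Iic a) :=
  ⟨nonempty_Iic, fun p hP ↦ hγ.not_tendsto_atBot_nhds_of_velocity_ne_zero hv p
    ((hasPastEndpoint_iff_tendsto_atBot Subset.rfl).mp hP)⟩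

/-- **A complete affinely parametrised geodesic with non-vanishing velocity is endless in both
directions**: a geodesic on `ℝ` (`IsGeodesic`) with `γ' ≠ 0` everywhere has neither a future nor a
past endpoint. O'Neill 1983, Ch. 5, Lemma 8; Hawking–Ellis 1973, §6.2 (inextendible curves).
[cite: ONeill1983, Ch. 5, Lemma 8] -/
theorem IsGeodesic.isFutureEndless_and_isPastEndless_of_velocity_ne_zero [T2Space M]
    [CovariantDerivative.ContMDiffCovariantDerivative cov 1]
    {γ : ℝ → M} (hγ : IsGeodesic cov γ) (hv : ∀ t, velocity I γ t ≠ 0) :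
    IsFutureEndless γ univ ∧ IsPastEndless γ univ := by
  refine ⟨⟨univ_nonempty, fun p hP ↦ ?_⟩, ⟨univ_nonempty, fun p hP ↦ ?_⟩⟩
  · exact (hγ.isGeodesicOn (Ici 0)).not_tendsto_nhds_of_velocity_ne_zero (fun t _ ↦ hv t) p
      ((hasFutureEndpoint_iff_tendsto_atTop (subset_univ (Ici (0 : ℝ)))).mp hP)
  · exact (hγ.isGeodesicOn (Iic 0)).not_tendsto_atBot_nhds_of_velocity_ne_zero (fun t _ ↦ hv t) p
      ((hasPastEndpoint_iff_tendsto_atBot (subset_univ (Iic (0 : ℝ)))).mp hP)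

end Connection

namespace PseudoRiemannianMetric

variable {n : ℕ∞ω} [FiniteDimensional ℝ E] [CompleteSpace E] [T2Space M]
  (g : PseudoRiemannianMetric I n E (TangentSpace I : M → Type _)) [g.HasLeviCivita]

/-- **Geodesic rays of a `C²` metric are future endless.** For the Levi-Civita connection of a `C²`
pseudo-Riemannian (in particular Lorentzian) metric on a Hausdorff manifold, an affinely
parametrised geodesic on `[a, ∞)` with nowhere-vanishing velocity — e.g. a null or timelike
geodesic ray — has no future endpoint (the Levi-Civita connection of a `C²` metric is `C¹`,
`isLocallyContMDiff_leviCivita_holds`, so `IsGeodesicOn.isFutureEndless_Ici_of_velocity_ne_zero`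
applies). O'Neill 1983, Ch. 5, Lemma 8; Hawking–Ellis 1973, §6.4 (future-inextendible null
geodesics in the non-imprisonment lemma, Prop. 6.4.7). [cite: ONeill1983, Ch. 5, Lemma 8] -/
theorem isFutureEndless_Ici_of_isGeodesicOn (hn : 2 ≤ n) {γ : ℝ → M} {a : ℝ}
    (hγ : IsGeodesicOn g.leviCivita γ (Ici a)) (hv : ∀ t, a ≤ t → velocity I γ t ≠ 0) :
    IsFutureEndless γ (Ici a) := by
  haveI : Fact (1 ≤ n) := ⟨le_trans (by norm_num) hn⟩
  haveI : CovariantDerivative.ContMDiffCovariantDerivative g.leviCivita 1 :=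
    ⟨g.isLocallyContMDiff_leviCivita_holds 1
      (by rw [show ((1 : ℕ∞) : ℕ∞ω) + 1 = 2 by norm_num]; exact hn) univ isOpen_univ⟩
  exact hγ.isFutureEndless_Ici_of_velocity_ne_zero hv

/-- **Time dual for a `C²` metric**: an affinely parametrised geodesic of the Levi-Civita
connection on `(-∞, a]` with nowhere-vanishing velocity has no past endpoint. O'Neill 1983,
Ch. 5, Lemma 8; Hawking–Ellis 1973, §6.2. [cite: ONeill1983, Ch. 5, Lemma 8] -/
theorem isPastEndless_Iic_of_isGeodesicOn (hn : 2 ≤ n) {γ : ℝ → M} {a : ℝ}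
    (hγ : IsGeodesicOn g.leviCivita γ (Iic a)) (hv : ∀ t, t ≤ a → velocity I γ t ≠ 0) :
    IsPastEndless γ (Iic a) := by
  haveI : Fact (1 ≤ n) := ⟨le_trans (by norm_num) hn⟩
  haveI : CovariantDerivative.ContMDiffCovariantDerivative g.leviCivita 1 :=
    ⟨g.isLocallyContMDiff_leviCivita_holds 1
      (by rw [show ((1 : ℕ∞) : ℕ∞ω) + 1 = 2 by norm_num]; exact hn) univ isOpen_univ⟩
  exact hγ.isPastEndless_Iic_of_velocity_ne_zero hv

end PseudoRiemannianMetric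

end Literature.Geometry.Lorentzian

end
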